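import Summits.KontsevichZagierPeriods.KontsevichZagierPeriods.Theorems.LinRedNormalFormArrangementNormalFormStubRebaseSimplePosManyAbove

/-!
# Stub `stub_rebaseSimplePosMany`, part `rebaseSimplePosMany_product` (crux `ArrangementNormalForm`, line `janus-bands`) — `Corner`

The COMPACTNESS DICHOTOMY for one lettered fibre of a product representation over a base of
dimension `B + 1` (the `K`-fibre port of `RebasePos.exists_pos_le_affF`,
`good_thick_of_noCorner`, `good_far_of_noCorner`, `good_above_of_corner`): an atom positive on a
closed bounded cell is bounded below by a positive constant there (extreme value theorem,
`RebaseMany.exists_pos_le_affF`); hence a band `0 < u < v` whose closed base cell `{rows ≥ 0}`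
contains no PINCH POINT (`0 ≤ u = v`) is thick (`RebaseMany.good_of_noPinch`), and a band above
its apex level `κ` (`u − κ = A (v − u)`, `A > 0`) in the configurations `κ < 0 < u < v` /
`0 < κ, 2κ ≤ v` whose closed cell contains no CORNER POINT (`κ = u = v = 0`) is thick
(`RebaseMany.good_thick_of_noCorner`, `good_far_of_noCorner`) — all closed by
`RebaseMany.good_thickBand`. The assembly `RebaseMany.good_above` runs the case tree of part
`Above` and delegates to a LOCAL residual handler `RebaseMany.HRl` (supplied by the residual
continuation hypothesis `HRc`, or by contradiction for fibres in general position) only bands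
with a pinch / corner point (`RebaseMany.IsResidual`). Registered: `rebaseSimplePosMany_above`.

References: M. Kontsevich, D. Zagier, *Periods* (2001), §1.2, rules (1a), (2).
-/

noncomputable section

open Set MeasureTheory MvPolynomial
open Literature.NumberTheory.Transcendental Literature.ModelTheory.ExponentialFields

namespace Summit.KontsevichZagierPeriods.ArrangementNormalForm.JanusBands

namespace RebaseMany

open SeparatePos RebasePos

variable {B K : ℕ}

/-! ### The extreme value theorem on a closed cell -/

/-- Atoms are continuous. [folklore] -/
theorem continuous_affF (d : Cf B) : Continuous fun z : Fin (B + 1 + K) → ℝ => affF B K d z := by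
  unfold affF
  fun_prop

/-- Non-strict rows of an extended row family. [folklore] -/
theorem rows_le_snoc_iff {m' : ℕ} (M : Fin m' → Cf B) (q : Cf B) (z : Fin (B + 1 + K) → ℝ) :
    (∀ j, 0 ≤ affF B K ((Fin.snoc M q : Fin (m' + 1) → Cf B) j) z) ↔
      (∀ j, 0 ≤ affF B K (M j) z) ∧ 0 ≤ affF B K q z := by
  simp only [Fin.forall_fin_succ', Fin.snoc_castSucc, Fin.snoc_last]

/-- **Extreme value theorem on a closed cell.** If the atom `φ` is positive at every point of
the closed cell `{∀ i, 0 ≤ Nᵢ}` with base coordinates bounded by `R`, it is bounded below there by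
a positive constant (the closed cell, normalised to `t = 0`, is compact). -/
theorem exists_pos_le_affF {k : ℕ} (N : Fin k → Cf B) (R : ℝ) (φ : Cf B)
    (hpos : ∀ z : Fin (B + 1 + K) → ℝ, (∀ i, 0 ≤ affF B K (N i) z) →
      (∀ j : Fin (B + 1), |z (Fin.castAdd K j)| ≤ R) → 0 < affF B K φ z) :
    ∃ c₀ : ℝ, 0 < c₀ ∧ ∀ z : Fin (B + 1 + K) → ℝ, (∀ i, 0 ≤ affF B K (N i) z) →
      (∀ j : Fin (B + 1), |z (Fin.castAdd K j)| ≤ R) → c₀ ≤ affF B K φ z := by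
  set Q : Set (Fin (B + 1 + K) → ℝ) := {z | (∀ i, 0 ≤ affF B K (N i) z) ∧
    (∀ j : Fin (B + 1), |z (Fin.castAdd K j)| ≤ R) ∧ ∀ i : Fin K, z (Fin.natAdd (B + 1) i) = 0} with hQ
  -- normalisation: all fibre coordinates `0`
  set nr : (Fin (B + 1 + K) → ℝ) → (Fin (B + 1 + K) → ℝ) := fun z =>
    Fin.append (fun j : Fin (B + 1) => z (Fin.castAdd K j)) (fun _ : Fin K => (0 : ℝ)) with hnr
  have hnr_base : ∀ z (j : Fin (B + 1)), nr z (Fin.castAdd K j) = z (Fin.castAdd K j) := fun z j => by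
    simp [hnr]
  have hnr_fib : ∀ z (i : Fin K), nr z (Fin.natAdd (B + 1) i) = 0 := fun z i => by simp [hnr]
  have hnr_aff : ∀ d z, affF B K d (nr z) = affF B K d z := fun d z => affF_congr d (hnr_base z)
  have hnorm : ∀ z : Fin (B + 1 + K) → ℝ, (∀ i, 0 ≤ affF B K (N i) z) →
      (∀ j : Fin (B + 1), |z (Fin.castAdd K j)| ≤ R) → nr z ∈ Q := fun z hN hR => by
    rw [hQ, mem_setOf_eq]
    exact ⟨fun i => by rw [hnr_aff]; exact hN i, fun j => by rw [hnr_base]; exact hR j, fun i => hnr_fib z i⟩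
  have hclosed : IsClosed Q := by
    rw [hQ]
    simp only [setOf_and, setOf_forall]
    exact (isClosed_iInter fun i => isClosed_le continuous_const (continuous_affF (N i))).inter
      ((isClosed_iInter fun j => isClosed_le ((continuous_apply _).abs) continuous_const).inter
        (isClosed_iInter fun i => isClosed_eq (continuous_apply _) continuous_const))
  have hbdd : Bornology.IsBounded Q := IntegrateOutLow.isBounded_of_forall_abs_le (max R 0) fun z hz l => by
    rw [hQ, mem_setOf_eq] at hz
    obtain ⟨-, hR, ht⟩ := hz
    refine Fin.addCases (fun j => (hR j).trans (le_max_left _ _)) (fun i => ?_) l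
    rw [ht i, abs_zero]
    exact le_max_right _ _
  have hcpt : IsCompact Q := Metric.isCompact_of_isClosed_isBounded hclosed hbdd
  rcases Q.eq_empty_or_nonempty with hemp | hne
  · refine ⟨1, one_pos, fun z hN hR => ?_⟩
    have h := hnorm z hN hR
    rw [hemp] at h
    exact absurd h (notMem_empty _)
  · obtain ⟨z₀, hz₀, hmin⟩ := hcpt.exists_isMinOn hne (continuous_affF φ).continuousOn
    have hz₀' := hz₀
    rw [hQ, mem_setOf_eq] at hz₀'
    refine ⟨affF B K φ z₀, hpos z₀ hz₀'.1 hz₀'.2.1, fun z hN hR => ?_⟩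
    have h := isMinOn_iff.1 hmin _ (hnorm z hN hR)
    rwa [hnr_aff] at h

/-! ### The local residual handler -/

/-- The LOCAL residual handler for the fibre `i` with data `(U, V, a)` and numerator `p` over the
base cell `cell K M₀`: every product representation with THESE data over a sub-cell whose closed
cell `{rows ≥ 0}` lies in that of `M₀`, and over which the fibre `i` is residual, is good. It is
supplied by the residual continuation hypothesis `HRc` (`HRc.toHRl`), or by CONTRADICTION when the
fibre `i` is in general position over the closed cell of `M₀` (no pinch / corner point).
[folklore] -/
def HRl (T : BData B) (i : Fin K) {m₀ : ℕ} (M₀ : Fin m₀ → Cf B) (U V : Fin K → Cf B)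
    (p : MvPolynomial (Fin B) ℚ) (a : Fin K → Option (Cf B)) : Prop :=
  ∀ (m' : ℕ) (s : KZ.IntegralRep (B + 1 + K)) (M : Fin m' → Cf B), IsProd s M U V T p a →
    (∀ z : Fin (B + 1 + K) → ℝ, (∀ j, 0 ≤ affF B K (M j) z) → ∀ j, 0 ≤ affF B K (M₀ j) z) →
    cell K M ⊆ cell K M₀ → IsResidual K M (U i) (V i) → Good B K (KZ.of s)

/-- The residual continuation hypothesis supplies the local residual handler. [folklore] -/
theorem HRc.toHRl {T : BData B} {i : Fin K} {m₀ : ℕ} {M₀ : Fin m₀ → Cf B} {U V : Fin K → Cf B}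
    {a : Fin K → Option (Cf B)} (hR : HRc T i M₀ U V a) (ha : a i = some 0)
    (p : MvPolynomial (Fin B) ℚ) : HRl T i M₀ U V p a :=
  fun _ _ _ h _ hsub hres => hR.apply h hsub ha hres (same_rfl i U V a)

/-- Closed cells of extended row families are smaller. [folklore] -/
theorem rows_le_of_snoc {m' : ℕ} (M : Fin m' → Cf B) (q : Cf B) {z : Fin (B + 1 + K) → ℝ}
    (hz : ∀ j, 0 ≤ affF B K ((Fin.snoc M q : Fin (m' + 1) → Cf B) j) z) : ∀ j, 0 ≤ affF B K (M j) z :=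
  ((rows_le_snoc_iff M q z).1 hz).1

section Corner

variable {s : KZ.IntegralRep (B + 1 + K)} {m' : ℕ} {M : Fin m' → Cf B} {U V : Fin K → Cf B}
  {T : BData B} {p : MvPolynomial (Fin B) ℚ} {a : Fin K → Option (Cf B)}

/-- **A band without pinch point is thick.** Fibre `i` with letter `0` and bounds `0 < u < v` on
the base cell whose closed base cell `{rows ≥ 0}` contains no point with `0 ≤ u = v` is good
(`good_thickBand`: on the compact closed cell `{rows ≥ 0, u ≥ 0, v − u ≥ 0}`, `v − u > 0`). -/
theorem good_of_noPinch (h : IsProd s M U V T p a) (i : Fin K) (ha : a i = some 0)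
    (hP : HPc T i M U V a)
    (hcell : ∀ z ∈ cell K M, 0 < affF B K (U i) z ∧ affF B K (U i) z < affF B K (V i) z)
    (hnp : ∀ z : Fin (B + 1 + K) → ℝ, (∀ j, 0 ≤ affF B K (M j) z) → 0 ≤ affF B K (U i) z →
      affF B K (U i) z = affF B K (V i) z → False) : Good B K (KZ.of s) := by
  obtain ⟨R, hR⟩ := h.cbd
  obtain ⟨c₀, hc₀, hge⟩ := exists_pos_le_affF (K := K)
    (Fin.snoc (Fin.snoc M (U i) : Fin (m' + 1) → Cf B) (V i - U i) : Fin (m' + 1 + 1) → Cf B) R (V i - U i)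
    fun z hN _ => by
      rw [rows_le_snoc_iff, rows_le_snoc_iff, affF_sub] at hN
      obtain ⟨⟨hrow, hu0⟩, hφ0⟩ := hN
      rw [affF_sub]
      rcases hφ0.eq_or_lt with h0 | hlt
      · exact absurd (by linarith) (hnp z hrow hu0)
      · exact hlt
  refine good_thickBand h i ha hP c₀ hc₀ fun z hz => ?_
  obtain ⟨hu, huv⟩ := hcell z hz
  have hge' := hge z (by
    rw [rows_le_snoc_iff, rows_le_snoc_iff, affF_sub]
    exact ⟨⟨fun j => le_of_lt ((mem_cell M z).1 hz j), hu.le⟩, by linarith⟩) (hR z hz)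
  rw [affF_sub] at hge'
  exact ⟨hu, by linarith⟩

/-- **`κ < 0 < u < v` without corner.** A band above its apex level `κ` with the apex level
below the letter (`u − κ = A (v − u)`, `A > 0`) whose closed base cell contains no corner point
(`κ = u = v = 0`) is thick (on the closed cell `{rows ≥ 0, −κ ≥ 0, u ≥ 0}`,
`v − u = (u − κ)/A ≥ 0` with equality only at a corner point), hence good. -/
theorem good_thick_of_noCorner (h : IsProd s M U V T p a) (i : Fin K) (ha : a i = some 0)
    (hP : HPc T i M U V a) (κ : Cf B) (A : ℚ) (hA : U i - κ = A • (V i - U i)) (hA0 : 0 < A)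
    (hcell : ∀ z ∈ cell K M, affF B K κ z < 0 ∧ 0 < affF B K (U i) z ∧ affF B K (U i) z < affF B K (V i) z)
    (hnc : ∀ z : Fin (B + 1 + K) → ℝ, (∀ j, 0 ≤ affF B K (M j) z) →
      affF B K κ z = 0 → affF B K (U i) z = 0 → affF B K (V i) z = 0 → False) :
    Good B K (KZ.of s) := by
  have huκ := affF_apex (K := K) hA
  have hA0' : (0 : ℝ) < A := by exact_mod_cast hA0
  obtain ⟨R, hR⟩ := h.cbd
  obtain ⟨c₀, hc₀, hge⟩ := exists_pos_le_affF (K := K)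
    (Fin.snoc (Fin.snoc M (-κ) : Fin (m' + 1) → Cf B) (U i) : Fin (m' + 1 + 1) → Cf B) R (V i - U i)
    fun z hN _ => by
      rw [rows_le_snoc_iff, rows_le_snoc_iff, affF_neg] at hN
      obtain ⟨⟨hrow, hκ0⟩, hu0⟩ := hN
      rw [affF_sub]
      by_contra hφ
      push Not at hφ
      have h1 := huκ z
      have hφ0 : affF B K (V i) z - affF B K (U i) z = 0 := by nlinarith
      rw [hφ0, mul_zero] at h1
      have hu : affF B K (U i) z = 0 := by linarith
      exact hnc z hrow (by linarith) hu (by linarith)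
  refine good_thickBand h i ha hP c₀ hc₀ fun z hz => ?_
  obtain ⟨hκ, hu, -⟩ := hcell z hz
  have hge' := hge z (by
    rw [rows_le_snoc_iff, rows_le_snoc_iff, affF_neg]
    exact ⟨⟨fun j => le_of_lt ((mem_cell M z).1 hz j), by linarith⟩, hu.le⟩) (hR z hz)
  rw [affF_sub] at hge'
  exact ⟨hu, by linarith⟩

/-- **`0 < κ`, `2κ ≤ v` without corner.** A band above its apex level `κ > 0` in the far regime
(`u − κ = A (v − u)`, `A > 0`) whose closed base cell contains no corner point is thick (on the
closed cell `{rows ≥ 0, κ ≥ 0, v − 2κ ≥ 0}`, `v − u = (v − κ)/(A + 1) ≥ κ/(A + 1) ≥ 0` with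
equality only at a corner point), hence good. -/
theorem good_far_of_noCorner (h : IsProd s M U V T p a) (i : Fin K) (ha : a i = some 0)
    (hP : HPc T i M U V a) (κ : Cf B) (A : ℚ) (hA : U i - κ = A • (V i - U i)) (hA0 : 0 < A)
    (hcell : ∀ z ∈ cell K M, 0 < affF B K κ z ∧ affF B K (U i) z < affF B K (V i) z ∧
      2 * affF B K κ z ≤ affF B K (V i) z)
    (hnc : ∀ z : Fin (B + 1 + K) → ℝ, (∀ j, 0 ≤ affF B K (M j) z) →
      affF B K κ z = 0 → affF B K (U i) z = 0 → affF B K (V i) z = 0 → False) :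
    Good B K (KZ.of s) := by
  have huκ := affF_apex (K := K) hA
  have hA0' : (0 : ℝ) < A := by exact_mod_cast hA0
  have h2κ : ∀ z : Fin (B + 1 + K) → ℝ, affF B K (V i - (2 : ℚ) • κ) z = affF B K (V i) z - 2 * affF B K κ z :=
    fun z => by rw [affF_sub, affF_smul]; push_cast; ring
  obtain ⟨R, hR⟩ := h.cbd
  obtain ⟨c₀, hc₀, hge⟩ := exists_pos_le_affF (K := K)
    (Fin.snoc (Fin.snoc M κ : Fin (m' + 1) → Cf B) (V i - (2 : ℚ) • κ) : Fin (m' + 1 + 1) → Cf B) R (V i - U i)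
    fun z hN _ => by
      rw [rows_le_snoc_iff, rows_le_snoc_iff, h2κ] at hN
      obtain ⟨⟨hrow, hκ0⟩, hfar⟩ := hN
      rw [affF_sub]
      by_contra hφ
      push Not at hφ
      have h1 := huκ z
      have hφ0 : affF B K (V i) z - affF B K (U i) z = 0 := by nlinarith
      have hκ : affF B K κ z = 0 := by nlinarith
      exact hnc z hrow hκ (by nlinarith) (by nlinarith)
  refine good_thickBand h i ha hP c₀ hc₀ fun z hz => ?_
  obtain ⟨hκ, huv, hfar⟩ := hcell z hz
  have hge' := hge z (by
    rw [rows_le_snoc_iff, rows_le_snoc_iff, h2κ]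
    exact ⟨⟨fun j => le_of_lt ((mem_cell M z).1 hz j), hκ.le⟩, by linarith⟩) (hR z hz)
  rw [affF_sub] at hge'
  refine ⟨?_, by linarith⟩
  nlinarith [huκ z]

/-- **A transverse band above its letter**, from the continuation hypothesis and the local
residual handler (pinched parallel bands and corner bands only). Case tree of part `Above`, plus
the compactness dichotomy of this file. -/
theorem good_above (h : IsProd s M U V T p a) (i : Fin K) (ha : a i = some 0)
    (hP : HPc T i M U V a) (hR : HRl T i M U V p a)
    (hu : (U i).1 (Fin.last B) ≠ 0) (hv : (V i).1 (Fin.last B) ≠ 0)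
    (hcell : ∀ z ∈ cell K M, 0 < affF B K (U i) z ∧ affF B K (U i) z < affF B K (V i) z) :
    Good B K (KZ.of s) := by
  by_cases hpar : (U i).1 (Fin.last B) = (V i).1 (Fin.last B)
  · by_cases hpin : ∃ z : Fin (B + 1 + K) → ℝ, (∀ j, 0 ≤ affF B K (M j) z) ∧ 0 ≤ affF B K (U i) z ∧
        affF B K (U i) z = affF B K (V i) z
    · exact hR _ s M h (fun z hz => hz) Subset.rfl (Or.inl ⟨hu, hpar, hcell, hpin⟩)
    · push Not at hpin
      exact good_of_noPinch h i ha hP hcell fun z h1 h2 h3 => hpin z h1 h2 h3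
  -- the apex level
  set A' : ℚ := (U i).1 (Fin.last B) with hA'
  set B' : ℚ := (V i).1 (Fin.last B) with hB'
  have hBA : B' - A' ≠ 0 := sub_ne_zero.2 (Ne.symm hpar)
  set A : ℚ := A' / (B' - A') with hAdef
  set κ : Cf B := U i - A • (V i - U i) with hκdef
  have hκ : κ.1 (Fin.last B) = 0 := by
    simp only [hκdef, Prod.fst_sub, Prod.smul_fst, Pi.sub_apply, Pi.smul_apply, smul_eq_mul, hAdef]
    rw [← hA', ← hB']
    field_simp
    ring
  have hA : U i - κ = A • (V i - U i) := by rw [hκdef, sub_sub_cancel]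
  have hA1 : A ≠ -1 := fun h1 => by
    have : A' = -(B' - A') := by
      rw [hAdef] at h1
      field_simp at h1
      linarith
    exact hv (show B' = 0 by linarith)
  have hA0 : A ≠ 0 := fun h0 => by
    rw [hAdef, div_eq_zero_iff] at h0
    exact h0.elim hu hBA
  have huκ := affF_apex (K := K) hA
  rcases lt_trichotomy A (-1) with hlt | heq | hgt
  · exact good_belowApex h i ha hP κ A hκ hA (by linarith) hcell
  · exact absurd heq hA1
  rcases lt_trichotomy A 0 with hlt0 | heq0 | hgt0
  · -- the apex level separates the bounds
    have hlt' : (A : ℝ) < 0 := by exact_mod_cast hlt0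
    have hgt' : (-1 : ℝ) < A := by exact_mod_cast hgt
    refine good_levelCut h i hP κ (yfree_of_letter_zero i ha κ hκ) fun z hz => ?_
    have h1 := huκ z
    have h2 := (hcell z hz).2
    constructor <;> nlinarith
  · exact absurd heq0 hA0
  -- above the apex (`A > 0`)
  by_cases hκ0 : κ = 0
  · exact good_coaxial h i 0 ha hP A (by rw [sub_zero, ← hA, hκ0, sub_zero]) fun z hz => (hcell z hz).2
  refine rowSplit h κ hκ0 (fun s₁ h₁ => ?_) (fun s₂ h₂ => ?_)
  · -- `κ > 0`: cut by the sign of `v - 2κ`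
    have hne : V i - (2 : ℚ) • κ ≠ 0 := ne_zero_of_last (by
      rw [sub_fst_last, smul_fst_last, hκ, mul_zero, sub_zero]
      exact hv)
    have h2κ : ∀ z : Fin (B + 1 + K) → ℝ, affF B K (V i - (2 : ℚ) • κ) z = affF B K (V i) z - 2 * affF B K κ z :=
      fun z => by rw [affF_sub, affF_smul]; push_cast; ring
    have hsub₁ : cell K (Fin.snoc M κ : Fin (m' + 1) → Cf B) ⊆ cell K M := cell_snoc_subset M κ
    refine rowSplit h₁ (V i - (2 : ℚ) • κ) hne (fun s₃ h₃ => ?_) (fun s₄ h₄ => ?_)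
    · -- far regime
      have hsub₃ : cell K (Fin.snoc (Fin.snoc M κ : Fin (m' + 1) → Cf B) (V i - (2 : ℚ) • κ) :
          Fin (m' + 1 + 1) → Cf B) ⊆ cell K M := (cell_snoc_subset _ _).trans hsub₁
      have hc₃ : ∀ z ∈ cell K (Fin.snoc (Fin.snoc M κ : Fin (m' + 1) → Cf B) (V i - (2 : ℚ) • κ) :
          Fin (m' + 1 + 1) → Cf B), 0 < affF B K κ z ∧ affF B K (U i) z < affF B K (V i) z ∧
          2 * affF B K κ z ≤ affF B K (V i) z := fun z hz => by
        obtain ⟨hz', hfar⟩ := (mem_cell_snoc _ _ z).1 hz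
        obtain ⟨hz'', hκpos⟩ := (mem_cell_snoc _ _ z).1 hz'
        rw [h2κ] at hfar
        exact ⟨hκpos, (hcell z hz'').2, by linarith⟩
      by_cases hcor : ∃ z : Fin (B + 1 + K) → ℝ, (∀ j, 0 ≤ affF B K ((Fin.snoc (Fin.snoc M κ :
          Fin (m' + 1) → Cf B) (V i - (2 : ℚ) • κ) : Fin (m' + 1 + 1) → Cf B) j) z) ∧
          affF B K κ z = 0 ∧ affF B K (U i) z = 0 ∧ affF B K (V i) z = 0
      · exact hR _ s₃ _ h₃ (fun z hz => rows_le_of_snoc M κ (rows_le_of_snoc _ _ hz)) hsub₃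
          (Or.inr ⟨κ, A, hκ, hA, hgt0, hcor, Or.inr hc₃⟩)
      · push Not at hcor
        exact good_far_of_noCorner h₃ i ha (hP.mono hsub₃) κ A hA hgt0 hc₃
          fun z h1 h2 h3 h4 => hcor z h1 h2 h3 h4
    · -- near regime
      refine good_nearApex h₄ i ha ((hP.mono hsub₁).mono (cell_snoc_subset _ _)) κ A 2 hκ hA hgt0
        fun z hz => ?_
      obtain ⟨hz', hnear⟩ := (mem_cell_snoc _ _ z).1 hz
      obtain ⟨hz'', hκpos⟩ := (mem_cell_snoc _ _ z).1 hz'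
      rw [affF_neg, h2κ] at hnear
      exact ⟨hκpos, (hcell z hz'').2, by linarith⟩
  · -- `κ < 0`
    have hsub₂ : cell K (Fin.snoc M (-κ) : Fin (m' + 1) → Cf B) ⊆ cell K M := cell_snoc_subset M _
    have hc₂ : ∀ z ∈ cell K (Fin.snoc M (-κ) : Fin (m' + 1) → Cf B),
        affF B K κ z < 0 ∧ 0 < affF B K (U i) z ∧ affF B K (U i) z < affF B K (V i) z := fun z hz => by
      obtain ⟨hz', hneg⟩ := (mem_cell_snoc _ _ z).1 hz
      rw [affF_neg] at hneg
      exact ⟨by linarith, hcell z hz'⟩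
    by_cases hcor : ∃ z : Fin (B + 1 + K) → ℝ, (∀ j, 0 ≤ affF B K ((Fin.snoc M (-κ) : Fin (m' + 1) → Cf B) j) z) ∧
        affF B K κ z = 0 ∧ affF B K (U i) z = 0 ∧ affF B K (V i) z = 0
    · exact hR _ s₂ _ h₂ (fun z hz => rows_le_of_snoc M _ hz) hsub₂ (Or.inr ⟨κ, A, hκ, hA, hgt0, hcor, Or.inl hc₂⟩)
    · push Not at hcor
      exact good_thick_of_noCorner h₂ i ha (hP.mono hsub₂) κ A hA hgt0 hc₂
        fun z h1 h2 h3 h4 => hcor z h1 h2 h3 h4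

end Corner

end RebaseMany

/-- Registered support goal of this file: a lettered fibre (letter `0`, transverse bounds) of a
product representation over a base of dimension `B + 1` lying above its letter is good, given the
continuation hypothesis over sub-cells and the local residual handler for pinched parallel bands
and corner bands (`RebaseMany.good_above`). -/
theorem rebaseSimplePosMany_above (B K m' : ℕ) (s : KZ.IntegralRep (B + 1 + K)) (M : Fin m' → (Fin (B + 1) → ℚ) × ℚ) (U V : Fin K → (Fin (B + 1) → ℚ) × ℚ) (T : RebaseMany.BData B) (p : MvPolynomial (Fin B) ℚ) (a : Fin K → Option ((Fin (B + 1) → ℚ) × ℚ)) (h : RebaseMany.IsProd s M U V T p a) (i : Fin K) (ha : a i = some 0) (hP : RebaseMany.HPc T i M U V a) (hR : RebaseMany.HRl T i M U V p a) (hu : (U i).1 (Fin.last B) ≠ 0) (hv : (V i).1 (Fin.last B) ≠ 0) (hcell : ∀ z ∈ RebaseMany.cell K M, 0 < SeparatePos.affF B K (U i) z ∧ SeparatePos.affF B K (U i) z < SeparatePos.affF B K (V i) z) : RebaseMany.Good B K (KZ.of s) :=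
  RebaseMany.good_above h i ha hP hR hu hv hcell

end Summit.KontsevichZagierPeriods.ArrangementNormalForm.JanusBands
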